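import Literature.Computability.QuantumComplexity.ClassicalWrapWF
import Literature.Computability.QuantumComplexity.CliffordTInverse
import Literature.Computability.QuantumComplexity.CircuitEmbedding
import HarnessLib

/-!
# The classical-wrap circuit family, Ic: compilation and the circuit family

Sequel of `ClassicalWrapLayout.lean` / `ClassicalWrapWF.lean`. The stage programs are compiled
exactly into Clifford+T (`compileOps`: `revCompile` of the `Fin`-reindexed program), the copies
`F.circ m` and their inverses `(F.circ m).inv` (`CliffordTInverse.lean`) are transported to the
front wires (`mapWires` along `frontEmb = Fin.castLEEmb`), and the pieces are assembled into
the circuit `wrapCircuit n = preGates ++ ⨁_{m < B n} iterGates m ++ postGates` and the family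
**`wrapFamily`** (ancillas `anc`), which is oracle-free for oracle-free `F`
(`wrapFamily_isOracleFree`). [Bernstein–Vazirani 1997, §8; Nielsen–Chuang 2010, §3.2.5, §4.4]

**Relation to `CWrap.family` (`CWrapFamily.lean`).** The tree holds a second, complete family
for the same named fact: `CWrap.family` is *space-multiplexed* — `L(n)+1` copies `F.circ ℓ` on
pairwise disjoint blocks of width `Pw(n)`, each brought to the front and back by a compiled swap
(wire conjugation), with the kernel bound `CWrapKernel.kernelProb_family_ge` and uniformity
`CWrapUniform.family_isUniform`; it is the line intended to discharge
`isQSolvable_classicalWrap`. The present `WrapData.wrapFamily` *complements* it as the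
*time-multiplexed* variant: the copies share one front window of width `bmax(n)` and are undone
by their inverse circuits (`CliffordTInverse.lean`), so the copies cost `bmax(n)` wires instead
of `(L(n)+1)·Pw(n)`, the semantics is the compute–copy–uncompute bookkeeping of
`UncomputeBranches.lean` rather than a product state over blocks, and uniformity goes through the
inverse-code transform `CliffordTInverseCodeFP.invCodeFn` of `F`'s descriptions and the shifted
clean blocks of `ShiftedCleanBlockDesc.lean` rather than wire conjugation. Its generic parts
(inverse circuits, branch sums, shifted printers, inverse-code brick) are shared infrastructure
already; the family-specific files (`ClassicalWrapLayout/WF/Circuit` and the sequels on stages,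
basis maps and the kernel bound) are kept as the alternative construction and may be pruned by the
librarian if only one line is wanted once an assembly lands. Naming caveat: `WrapData.copyGates`
below is the `cur`-controlled *copy-out stage* (`copyGz`), whereas `CWrap.copyGates` is the
placed copy of `F.circ ℓ`; the two short names have opposite meanings.

## References

* E. Bernstein, U. Vazirani, *Quantum complexity theory*, SIAM J. Comput. 26 (1997), §8.
* C. H. Bennett, E. Bernstein, G. Brassard, U. Vazirani, *Strengths and weaknesses of quantum
  computing*, SIAM J. Comput. 26 (1997) 1510–1523, Thm. 4.14 (proof).
* M. A. Nielsen, I. L. Chuang, *Quantum Computation and Quantum Information*, CUP 2010,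
  §3.2.5, §4.4.
-/

noncomputable section

namespace Literature.Computability.QuantumComplexity

namespace ClassicalWrap

open Turing Function Cryptography Complexity Complexity.FinTM2Sim RevSim RevClean

namespace WrapData

variable (D : WrapData)

/-! ### Compilation and the circuit family -/

section Circuit

/-- The front embedding of the `b`-wire register (`b ≤ Wtot`): wire `i ↦ i`. [folklore] -/
def frontEmb {b n : ℕ} (h : b ≤ D.Wtot n) : Fin b ↪ Fin (D.Wtot n) := Fin.castLEEmb h

/-- The gates of `F.circ m` transported to the front (empty if the copy does not fit, which
does not happen for `m < B` under the ancilla bound). [cite: BernsteinVazirani1997, §8] -/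
def fGates (n m : ℕ) : List (QGate cliffordT (D.Wtot n)) :=
  if h : D.bF m ≤ D.Wtot n then (mapWires (D.frontEmb h) (D.F.circ m)).gates else []

/-- The gates of the inverse `(F.circ m).inv` transported to the front. [cite: NielsenChuang2010, §3.2.5] -/
def fInvGates (n m : ℕ) : List (QGate cliffordT (D.Wtot n)) :=
  if h : D.bF m ≤ D.Wtot n then (mapWires (D.frontEmb h) (D.F.circ m).inv).gates else []

/-- The compiled pre-processing stage. [folklore] -/
def preGates (n : ℕ) : List (QGate cliffordT (D.Wtot n)) :=
  compileOps (D.Wtot n) (Wtot_pos n) (D.preOps n) (preOps_wf n)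
    fun op hop i hi => (preOps_lt n op hop i hi).trans_le (R4_add_le_Wtot n)

/-- The compiled `cur` stage of iteration `m`. [folklore] -/
def curGates (n m : ℕ) : List (QGate cliffordT (D.Wtot n)) :=
  if hm : m < D.B n then
    compileOps (D.Wtot n) (Wtot_pos n) (D.curOps n m) (curOps_wf n m hm) fun op hop i hi =>
      (curOps_lt n m hm op hop i hi).trans_le ((Nat.le_add_right _ _).trans (R4_add_le_Wtot n))
  else []

/-- The compiled copy stage of width `b` (`b ≤ bmax`, else empty). [folklore] -/
def copyGates (n b : ℕ) : List (QGate cliffordT (D.Wtot n)) :=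
  if hb : b ≤ D.bmax n then
    compileOps (D.Wtot n) (Wtot_pos n) (D.copyOps' n b) (copyOps'_wf n b hb) fun op hop i hi =>
      (copyOps'_lt n b hb op hop i hi).trans_le (R5_le_Wtot n)
  else []

/-- The compiled post-processing stage. [folklore] -/
def postGates (n : ℕ) : List (QGate cliffordT (D.Wtot n)) :=
  compileOps (D.Wtot n) (Wtot_pos n) (D.postOps n) (postOps_wf n) (postOps_lt n)

/-- **Iteration `m`**: flag to `cur`, `F.circ m` on the front, controlled copy of its `bF m`
wires into the zone, `(F.circ m).inv`, flag to `cur` again.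
[cite: BennettBernsteinBrassardVazirani1997, Thm. 4.14 (proof)] [cite: NielsenChuang2010, §3.2.5] -/
def iterGates (n m : ℕ) : List (QGate cliffordT (D.Wtot n)) :=
  D.curGates n m ++ D.fGates n m ++ D.copyGates n (D.bF m) ++ D.fInvGates n m ++ D.curGates n m

/-- **The classical-wrap circuit** for input length `n`. [cite: BernsteinVazirani1997, §8] -/
def wrapCircuit (n : ℕ) : QCircuit cliffordT (D.Wtot n) :=
  ⟨D.preGates n ++ (List.range (D.B n)).flatMap (D.iterGates n) ++ D.postGates n⟩

/-- **The classical-wrap circuit family** (`anc n` ancillas). [cite: BernsteinVazirani1997, §8] -/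
def wrapFamily : QCircuitFamily cliffordT := ⟨D.anc, D.wrapCircuit⟩

/-- The circuits of the family (definitional). [folklore] -/
@[simp] theorem wrapFamily_circ (n : ℕ) : D.wrapFamily.circ n = D.wrapCircuit n := rfl

/-- The ancillas of the family (definitional). [folklore] -/
@[simp] theorem wrapFamily_ancillas (n : ℕ) : D.wrapFamily.ancillas n = D.anc n := rfl

/-- The gates of the circuit (definitional). [folklore] -/
theorem gates_wrapCircuit (n : ℕ) :
    (D.wrapCircuit n).gates = D.preGates n ++ (List.range (D.B n)).flatMap (D.iterGates n) ++ D.postGates n := rfl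

/-- The transported gates of an oracle-free `F` are oracle-free. [folklore] -/
theorem fGates_isOracleFree (hF : D.F.IsOracleFree) (n m : ℕ) : ∀ g ∈ D.fGates n m, g.IsOracleFree := by
  intro g hg
  unfold fGates at hg
  split_ifs at hg with h
  · exact isOracleFree_mapWires _ (hF m) g hg
  · simp at hg

/-- The transported inverse gates of an oracle-free `F` are oracle-free. [folklore] -/
theorem fInvGates_isOracleFree (hF : D.F.IsOracleFree) (n m : ℕ) : ∀ g ∈ D.fInvGates n m, g.IsOracleFree := by
  intro g hg
  unfold fInvGates at hg
  split_ifs at hg with h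
  · exact isOracleFree_mapWires _ (QCircuit.inv_isOracleFree (hF m)) g hg
  · simp at hg

/-- The compiled `cur` stage is oracle-free. [folklore] -/
theorem curGates_isOracleFree (n m : ℕ) : ∀ g ∈ D.curGates n m, g.IsOracleFree := by
  intro g hg
  unfold curGates at hg
  split_ifs at hg with h
  · exact compileOps_isOracleFree _ _ _ _ _ g hg
  · simp at hg

/-- The compiled copy stage is oracle-free. [folklore] -/
theorem copyGates_isOracleFree (n b : ℕ) : ∀ g ∈ D.copyGates n b, g.IsOracleFree := by
  intro g hg
  unfold copyGates at hg
  split_ifs at hg with h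
  · exact compileOps_isOracleFree _ _ _ _ _ g hg
  · simp at hg

/-- **The classical-wrap family is oracle-free** (for oracle-free `F`). [cite: BernsteinVazirani1997, §8] -/
theorem wrapFamily_isOracleFree (hF : D.F.IsOracleFree) : D.wrapFamily.IsOracleFree := by
  intro n g hg
  rw [wrapFamily_circ, gates_wrapCircuit] at hg
  rcases List.mem_append.1 hg with hg | hg
  · rcases List.mem_append.1 hg with hg | hg
    · exact compileOps_isOracleFree _ _ _ _ _ g hg
    · obtain ⟨m, -, hg⟩ := List.mem_flatMap.1 hg
      unfold iterGates at hg
      rcases List.mem_append.1 hg with hg | hg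
      · rcases List.mem_append.1 hg with hg | hg
        · rcases List.mem_append.1 hg with hg | hg
          · rcases List.mem_append.1 hg with hg | hg
            · exact curGates_isOracleFree D n m g hg
            · exact fGates_isOracleFree D hF n m g hg
          · exact copyGates_isOracleFree D n _ g hg
        · exact fInvGates_isOracleFree D hF n m g hg
      · exact curGates_isOracleFree D n m g hg
  · exact compileOps_isOracleFree _ _ _ _ _ g hg

end Circuit

end WrapData

end ClassicalWrap

end Literature.Computability.QuantumComplexity
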